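import Literature.MathematicalPhysics.QuantumLattice.HubbardHalfFilledGroundState
import Literature.MathematicalPhysics.QuantumLattice.HubbardLiebTwoHoppingsSector
import HarnessLib

/-!
# THE half-filled ground state of the square-torus Hubbard model (Lieb's hypotheses discharged)

Family `hubbard` (trunk T-QLATTICE); companion of `HubbardHalfFilledGroundState` for the
certified-numerics cell `pub-mbboot`. On the even square torus `(ℤ/Lℤ)²` (graph
`fermionTorusGraph 2 L`, `L` even, `L ≠ 0`) all graph-theoretic hypotheses of Lieb's Theorem 2
are tree facts — connectivity (`LiebTwoHoppings.fermionTorusGraph_connected`), the bipartition by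
the staggering sign `ε_x = (-1)^{x₁+x₂}` (`torusStagger_eq_neg_of_adj_holds`) and the equality of
the two sublattices (`LiebTwoHoppings.two_mul_card_filter_torusStagger_eq_one`) — so the
`LiebHalfFilled` theorems hold with only the physical hypotheses `t ≠ 0`, `U > 0` left:

* `LiebHalfFilled.hubbardTorus_finrank_groundSector_eq_one` — the `L²`-particle ground
  multiplet of `hamiltonian (fermionTorusGraph 2 L) t U` is one-dimensional and singlet;
* `LiebHalfFilled.hubbardTorus_exists_unit_groundState` — THE ground state: a unit vector of the
  central sector `szSector (L²) 0`, every `L²`-particle ground state is `⟨ψ, φ⟩ ψ`, the tracial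
  `L²`-particle ground state is `O ↦ ⟨ψ, O ψ⟩`;
* `LiebHalfFilled.hubbardTorus_groundEnergyAt_lt_minEnergyOn_szSector_one` — positive spin gap;
* `LiebHalfFilled.hubbardTorus_groundState_certificate`,
  `LiebHalfFilled.hubbardTorus_groundState_expectation_certificate` — a Kato–Temple certificate in
  the central sector bounds the energy and the expectations of THE ground state.

## References

* E. H. Lieb, *Two theorems on the Hubbard model*, Phys. Rev. Lett. 62 (1989) 1201, Theorem 2.
  [LiebPRL1989]
* S. Friedli, Y. Velenik, *Statistical Mechanics of Lattice Systems* (2017), §3.1 (the torus).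
  [FriedliVelenikSMLS2017]
-/

noncomputable section

namespace Literature.MathematicalPhysics.QuantumLattice

namespace LiebHalfFilled

open Matrix Finset Literature.Probability.LatticeModels
open scoped ComplexOrder

section Generic

variable {Λ : Type*} [LinearOrder Λ] [Fintype Λ]

/-- `2|A| = |Λ| ⇒ |Aᶜ| = |A|` (in the instance context of `HubbardHalfFilledGroundState`). [folklore] -/
theorem compl_card_eq_card_of_two_mul {A : Finset Λ} (h2 : 2 * A.card = Fintype.card Λ) :
    Aᶜ.card = A.card := by
  have := Finset.card_add_card_compl A
  omega

end Generic

variable {L : ℕ} [NeZero L]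

/-- **Lieb's hypotheses on the even square torus.** For even `L ≠ 0`, with `A` the sublattice
`{x : ε_x = +1}` of the staggering sign: the torus graph is connected, `A` is a bipartition class
(`x ∼ y → (x ∈ A ↔ y ∉ A)`), `2|A| = |Λ|`, and `A` is nonempty.
[cite: LiebPRL1989, Theorem 2 (bipartite lattice, `|A| = |B|`)] -/
theorem hubbardTorus_lieb_hypotheses (hL : Even L) :
    (fermionTorusGraph 2 L).Connected ∧
      (∀ x y : FermionTorus 2 L, (fermionTorusGraph 2 L).Adj x y →
        (x ∈ (univ.filter fun x : FermionTorus 2 L => torusStagger x = 1) ↔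
          y ∉ (univ.filter fun x : FermionTorus 2 L => torusStagger x = 1))) ∧
      2 * (univ.filter fun x : FermionTorus 2 L => torusStagger x = 1).card =
        Fintype.card (FermionTorus 2 L) ∧
      (univ.filter fun x : FermionTorus 2 L => torusStagger x = 1).Nonempty := by
  set A : Finset (FermionTorus 2 L) := univ.filter fun x : FermionTorus 2 L => torusStagger x = 1
    with hA
  have hmemA : ∀ x, x ∈ A ↔ torusStagger x = 1 := fun x => by
    rw [hA, mem_filter]
    exact ⟨fun h => h.2, fun h => ⟨mem_univ _, h⟩⟩
  have hAadj : ∀ x y : FermionTorus 2 L, (fermionTorusGraph 2 L).Adj x y → (x ∈ A ↔ y ∉ A) := by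
    intro x y hxy
    have h := torusStagger_eq_neg_of_adj_holds hL hxy
    rw [hmemA, hmemA, h]
    change -torusStagger y = 1 ↔ torusStagger y ≠ 1
    rw [Int.units_ne_iff_eq_neg, neg_eq_iff_eq_neg]
  have h2 := LiebTwoHoppings.two_mul_card_filter_torusStagger_eq_one (L := L) hL
  rw [← hA] at h2
  have hL0 : 0 < L := Nat.pos_of_ne_zero (NeZero.ne L)
  have hne : A.Nonempty := by
    rw [← Finset.card_pos]
    have : 0 < L ^ 2 := by positivity
    omega
  refine ⟨LiebTwoHoppings.fermionTorusGraph_connected 2 L, hAadj, ?_, hne⟩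
  rw [h2]
  simp only [FermionTorus, Fintype.card_lex, Fintype.card_fun, Fintype.card_fin]

/-- **Lieb's Theorem 2 on the even square torus**: for even `L ≠ 0`, `t ≠ 0`, `U > 0`, the
`L²`-particle (half-filled) ground multiplet of `hamiltonian (fermionTorusGraph 2 L) t U` is
one-dimensional and consists of singlets. [cite: LiebPRL1989, Theorem 2] -/
theorem hubbardTorus_finrank_groundSector_eq_one (hL : Even L) {t U : ℝ} (ht : t ≠ 0) (hU : 0 < U) :
    Module.finrank ℂ ((hamiltonian (fermionTorusGraph 2 L) t U).sectorGroundSpace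
        (nParticleSubmodule (ι := Orb (FermionTorus 2 L)) (L ^ 2))) = 1 ∧
      ∀ ψ ∈ (hamiltonian (fermionTorusGraph 2 L) t U).sectorGroundSpace
          (nParticleSubmodule (ι := Orb (FermionTorus 2 L)) (L ^ 2)), spinSq *ᵥ ψ = 0 := by
  obtain ⟨hG, hA, h2, -⟩ := hubbardTorus_lieb_hypotheses (L := L) hL
  have hcard := compl_card_eq_card_of_two_mul h2
  have h := finrank_groundSector_eq_one hG _ hA hcard ht hU
  rwa [(show Fintype.card (FermionTorus 2 L) = L ^ 2 by
    simp only [FermionTorus, Fintype.card_lex, Fintype.card_fun, Fintype.card_fin])] at h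

/-- **The half-filled ground states of the even square torus lie in the central sector**
`N↑ = N↓ = L²/2`. [cite: LiebPRL1989, Theorem 2] -/
theorem hubbardTorus_groundSector_le_szSector (hL : Even L) {t U : ℝ} (ht : t ≠ 0) (hU : 0 < U) :
    (hamiltonian (fermionTorusGraph 2 L) t U).sectorGroundSpace
        (nParticleSubmodule (ι := Orb (FermionTorus 2 L)) (L ^ 2)) ≤ szSector (L ^ 2) 0 := by
  obtain ⟨hG, hA, h2, -⟩ := hubbardTorus_lieb_hypotheses (L := L) hL
  have hcard := compl_card_eq_card_of_two_mul h2
  have h := groundSector_le_szSector hG _ hA hcard ht hU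
  rwa [(show Fintype.card (FermionTorus 2 L) = L ^ 2 by
    simp only [FermionTorus, Fintype.card_lex, Fintype.card_fun, Fintype.card_fin])] at h

/-- **The central sector's ground projection is THE half-filled ground projection** on the even
square torus. [cite: LiebPRL1989, Theorem 2] -/
theorem hubbardTorus_sectorGroundProj_szSector_eq (hL : Even L) {t U : ℝ} (ht : t ≠ 0)
    (hU : 0 < U) :
    (hamiltonian (fermionTorusGraph 2 L) t U).sectorGroundProj (szSector (L ^ 2) 0) =
      (hamiltonian (fermionTorusGraph 2 L) t U).sectorGroundProj
        (nParticleSubmodule (ι := Orb (FermionTorus 2 L)) (L ^ 2)) := by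
  obtain ⟨hG, hA, h2, -⟩ := hubbardTorus_lieb_hypotheses (L := L) hL
  have hcard := compl_card_eq_card_of_two_mul h2
  have h := sectorGroundProj_szSector_eq hG _ hA hcard ht hU
  rw [(show Fintype.card (FermionTorus 2 L) = L ^ 2 by
    simp only [FermionTorus, Fintype.card_lex, Fintype.card_fun, Fintype.card_fin])] at h
  convert h using 2

/-- **THE half-filled ground state of the even square torus.** For even `L ≠ 0`, `t ≠ 0`, `U > 0`
there is a unit vector `ψ ∈ szSector (L²) 0` with `H ψ = E₀(L²) ψ`, `S² ψ = 0`; every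
`L²`-particle ground state is `⟨ψ, φ⟩ ψ`; and the tracial `L²`-particle ground state is
`O ↦ ⟨ψ, O ψ⟩`. [cite: LiebPRL1989, Theorem 2] -/
theorem hubbardTorus_exists_unit_groundState (hL : Even L) {t U : ℝ} (ht : t ≠ 0) (hU : 0 < U) :
    ∃ ψ ∈ szSector (L ^ 2) 0, star ψ ⬝ᵥ ψ = 1 ∧
      hamiltonian (fermionTorusGraph 2 L) t U *ᵥ ψ =
        ((groundEnergyAt (fermionTorusGraph 2 L) t U (L ^ 2) : ℝ) : ℂ) • ψ ∧
      spinSq *ᵥ ψ = 0 ∧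
      (∀ φ : Fock (Orb (FermionTorus 2 L)), IsNParticle (L ^ 2) φ →
        hamiltonian (fermionTorusGraph 2 L) t U *ᵥ φ =
          ((groundEnergyAt (fermionTorusGraph 2 L) t U (L ^ 2) : ℝ) : ℂ) • φ →
          φ = (star ψ ⬝ᵥ φ) • ψ) ∧
      ∀ O : Matrix (Finset (Orb (FermionTorus 2 L))) (Finset (Orb (FermionTorus 2 L))) ℂ,
        ((hamiltonian (fermionTorusGraph 2 L) t U).sectorGroundProj
            (nParticleSubmodule (ι := Orb (FermionTorus 2 L)) (L ^ 2))).projState O =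
          star ψ ⬝ᵥ O *ᵥ ψ := by
  obtain ⟨hfin, hspin⟩ := hubbardTorus_finrank_groundSector_eq_one (L := L) hL ht hU
  set H := hamiltonian (fermionTorusGraph 2 L) t U with hH
  set K : Submodule ℂ (Fock (Orb (FermionTorus 2 L))) :=
    nParticleSubmodule (ι := Orb (FermionTorus 2 L)) (L ^ 2) with hK
  set V := H.sectorGroundSpace K with hV
  have hHerm : H.IsHermitian := LiebThm1.hamiltonian_isHermitian (fermionTorusGraph 2 L) t U
  have hVne : V ≠ ⊥ := by
    intro h
    rw [h, finrank_bot] at hfin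
    exact zero_ne_one hfin
  have hKne : K ≠ ⊥ := by
    intro h
    apply hVne
    rw [eq_bot_iff]
    intro v hv
    rw [← h]
    exact ((Matrix.mem_sectorGroundSpace_iff _ _ _).1 hv).1
  obtain ⟨ψ, hψK, hψ1, hHψ⟩ := exists_unit_eigen_minEnergyOn hHerm K
    (fun v hv => hamiltonian_mulVec_mem_nParticleSubmodule (fermionTorusGraph 2 L) t U hv) hKne
  have hE : groundEnergyAt (fermionTorusGraph 2 L) t U (L ^ 2) = H.minEnergyOn K :=
    groundEnergy_eq_minEnergyOn H (L ^ 2) K (fun _ => Iff.rfl)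
  have hψV : ψ ∈ V := (Matrix.mem_sectorGroundSpace_iff _ _ _).2 ⟨hψK, hHψ⟩
  have hψ0 : ψ ≠ 0 := by
    rintro rfl
    rw [dotProduct_zero] at hψ1
    exact zero_ne_one hψ1
  have hne : (⟨ψ, hψV⟩ : V) ≠ 0 := fun h => hψ0 (by simpa using congrArg Subtype.val h)
  have huniq : ∀ φ ∈ K, H *ᵥ φ = ((H.minEnergyOn K : ℝ) : ℂ) • φ → φ = (star ψ ⬝ᵥ φ) • ψ := by
    intro φ hφK hHφ
    have hφV : φ ∈ V := (Matrix.mem_sectorGroundSpace_iff _ _ _).2 ⟨hφK, hHφ⟩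
    obtain ⟨a, ha⟩ := (finrank_eq_one_iff_of_nonzero' _ hne).1 hfin ⟨φ, hφV⟩
    have hφeq : φ = a • ψ := by simpa using (congrArg Subtype.val ha).symm
    rw [hφeq, dotProduct_smul, hψ1, smul_eq_mul, mul_one]
  obtain ⟨-, hstate⟩ := TempleKato.projState_sectorGroundProj_eq K hψK hψ1 hHψ huniq
  refine ⟨ψ, hubbardTorus_groundSector_le_szSector hL ht hU hψV, hψ1, ?_, hspin ψ hψV, ?_, hstate⟩
  · rw [hE]; exact hHψ
  · intro φ hφN hHφ
    rw [hE] at hHφ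
    exact huniq φ hφN hHφ

/-- **Positive spin gap on the even square torus at half filling**:
`E₀(L²) < λ_min(szSector L² 1)` (every multiplet of spin `S ≥ 1` has a member in `S^z = 1`).
[cite: LiebPRL1989, Theorem 2] -/
theorem hubbardTorus_groundEnergyAt_lt_minEnergyOn_szSector_one (hL : Even L) {t U : ℝ} (ht : t ≠ 0)
    (hU : 0 < U) :
    groundEnergyAt (fermionTorusGraph 2 L) t U (L ^ 2) <
      (hamiltonian (fermionTorusGraph 2 L) t U).minEnergyOn (szSector (L ^ 2) 1) := by
  obtain ⟨hG, hA, h2, hne⟩ := hubbardTorus_lieb_hypotheses (L := L) hL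
  have hcard := compl_card_eq_card_of_two_mul h2
  have h := groundEnergyAt_lt_minEnergyOn_szSector_one hG _ hA hcard hne ht hU
  rw [(show Fintype.card (FermionTorus 2 L) = L ^ 2 by
    simp only [FermionTorus, Fintype.card_lex, Fintype.card_fun, Fintype.card_fin])] at h
  convert h using 2

/-- **Kato–Temple certificate in the central sector ⇒ THE half-filled ground state of the even
square torus.** For even `L ≠ 0`, `t ≠ 0`, `U > 0`: a gap certificate `(W, u)` with threshold `σ`
for `K = szSector (L²) 0` and a unit trial vector `w ∈ K` with `Re ⟨w, H w⟩ = ρ < σ`,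
`‖H w‖² ≤ r² + ρ²` give `ρ - r²/(σ - ρ) ≤ E₀(L²) ≤ ρ`, THE ground state `ψ` (unit, in `K`, every
`L²`-particle ground state `= ⟨ψ, φ⟩ ψ`, tracial ground state `= ⟨ψ, · ψ⟩`) and
`(1 - |⟨ψ, w⟩|²)(σ - ρ)² ≤ r²`. [cite: LiebPRL1989, Theorem 2] -/
theorem hubbardTorus_groundState_certificate (hL : Even L) {t U : ℝ} (ht : t ≠ 0) (hU : 0 < U)
    {W : Submodule ℂ (Fock (Orb (FermionTorus 2 L)))} {u : Fock (Orb (FermionTorus 2 L))} {σ : ℝ}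
    (hW : ∀ z ∈ W, σ * (star z ⬝ᵥ z).re ≤
      (star z ⬝ᵥ hamiltonian (fermionTorusGraph 2 L) t U *ᵥ z).re)
    (hWK : ∀ x ∈ szSector (L ^ 2) 0, ∃ z ∈ W, ∃ c : ℂ, x = z + c • u)
    {w : Fock (Orb (FermionTorus 2 L))} (hwK : w ∈ szSector (L ^ 2) 0) (hw1 : star w ⬝ᵥ w = 1)
    {ρ r2 : ℝ} (hρ : (star w ⬝ᵥ hamiltonian (fermionTorusGraph 2 L) t U *ᵥ w).re = ρ)
    (hr2 : (star (hamiltonian (fermionTorusGraph 2 L) t U *ᵥ w) ⬝ᵥ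
      hamiltonian (fermionTorusGraph 2 L) t U *ᵥ w).re ≤ r2 + ρ ^ 2)
    (hρσ : ρ < σ) :
    ρ - r2 / (σ - ρ) ≤ groundEnergyAt (fermionTorusGraph 2 L) t U (L ^ 2) ∧
      groundEnergyAt (fermionTorusGraph 2 L) t U (L ^ 2) ≤ ρ ∧
      ∃ ψ ∈ szSector (L ^ 2) 0, star ψ ⬝ᵥ ψ = 1 ∧
        hamiltonian (fermionTorusGraph 2 L) t U *ᵥ ψ =
          ((groundEnergyAt (fermionTorusGraph 2 L) t U (L ^ 2) : ℝ) : ℂ) • ψ ∧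
        (∀ φ : Fock (Orb (FermionTorus 2 L)), IsNParticle (L ^ 2) φ →
          hamiltonian (fermionTorusGraph 2 L) t U *ᵥ φ =
            ((groundEnergyAt (fermionTorusGraph 2 L) t U (L ^ 2) : ℝ) : ℂ) • φ →
            φ = (star ψ ⬝ᵥ φ) • ψ) ∧
        (∀ O : Matrix (Finset (Orb (FermionTorus 2 L))) (Finset (Orb (FermionTorus 2 L))) ℂ,
          ((hamiltonian (fermionTorusGraph 2 L) t U).sectorGroundProj
              (nParticleSubmodule (ι := Orb (FermionTorus 2 L)) (L ^ 2))).projState O =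
            star ψ ⬝ᵥ O *ᵥ ψ) ∧
        (1 - ‖star ψ ⬝ᵥ w‖ ^ 2) * (σ - ρ) ^ 2 ≤ r2 := by
  set H := hamiltonian (fermionTorusGraph 2 L) t U with hH
  have hΛ : L ^ 2 = 2 * (L ^ 2 / 2) := by
    obtain ⟨m, hm⟩ := hL
    subst hm
    have : (m + m) ^ 2 = 2 * (2 * m ^ 2) := by ring
    omega
  have hn : L ^ 2 / 2 ≤ Fintype.card (FermionTorus 2 L) := by
    rw [(show Fintype.card (FermionTorus 2 L) = L ^ 2 by
    simp only [FermionTorus, Fintype.card_lex, Fintype.card_fun, Fintype.card_fin])]; omega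
  have hHerm : H.IsHermitian := LiebThm1.hamiltonian_isHermitian (fermionTorusGraph 2 L) t U
  have hE : groundEnergyAt (fermionTorusGraph 2 L) t U (L ^ 2) = H.minEnergyOn (szSector (L ^ 2) 0) := by
    rw [hΛ]; exact groundEnergyAt_eq_minEnergyOn_szSector (fermionTorusGraph 2 L) t U hn
  obtain ⟨h1, h2, ψ, hψK, hψ1, hHψ, huniq, -, hsin⟩ :=
    TempleKato.sector_enclosure hHerm (szSector (L ^ 2) 0)
      (fun v hv => hamiltonian_mulVec_mem_szSector (fermionTorusGraph 2 L) t U hv)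
      hW hWK hwK hw1 hρ hr2 hρσ
  obtain ⟨-, hstate⟩ := TempleKato.projState_sectorGroundProj_eq (szSector (L ^ 2) 0) hψK hψ1 hHψ huniq
  rw [← hE] at h1 h2 hHψ huniq
  rw [hubbardTorus_sectorGroundProj_szSector_eq hL ht hU] at hstate
  refine ⟨h1, h2, ψ, hψK, hψ1, hHψ, fun φ hφN hHφ => ?_, hstate, hsin⟩
  have hφV : φ ∈ H.sectorGroundSpace (nParticleSubmodule (ι := Orb (FermionTorus 2 L)) (L ^ 2)) :=
    (mem_groundSector_iff (fermionTorusGraph 2 L) t U (L ^ 2) φ).2 ⟨hφN, hHφ⟩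
  exact huniq φ (hubbardTorus_groundSector_le_szSector hL ht hU hφV) hHφ

/-- **Certified interval for an expectation in THE half-filled ground state of the even square
torus** (Kato–Temple + mixing in the central sector; Lieb's hypotheses discharged): with the data
of `hubbardTorus_groundState_certificate`, an observable `O` with `|⟨x, (O - m) x⟩| ≤ h ‖x‖²`, and
`β ≥ 0` with `r² ≤ β²(σ - ρ)²`,
`|Re ω₀(O) - Re ⟨w, O w⟩| ≤ 2 h (β + β²)` for the tracial `L²`-particle ground state `ω₀`.
[cite: LiebPRL1989, Theorem 2] -/
theorem hubbardTorus_groundState_expectation_certificate (hL : Even L) {t U : ℝ} (ht : t ≠ 0)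
    (hU : 0 < U)
    {W : Submodule ℂ (Fock (Orb (FermionTorus 2 L)))} {u : Fock (Orb (FermionTorus 2 L))} {σ : ℝ}
    (hW : ∀ z ∈ W, σ * (star z ⬝ᵥ z).re ≤
      (star z ⬝ᵥ hamiltonian (fermionTorusGraph 2 L) t U *ᵥ z).re)
    (hWK : ∀ x ∈ szSector (L ^ 2) 0, ∃ z ∈ W, ∃ c : ℂ, x = z + c • u)
    {w : Fock (Orb (FermionTorus 2 L))} (hwK : w ∈ szSector (L ^ 2) 0) (hw1 : star w ⬝ᵥ w = 1)
    {ρ r2 : ℝ} (hρ : (star w ⬝ᵥ hamiltonian (fermionTorusGraph 2 L) t U *ᵥ w).re = ρ)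
    (hr2 : (star (hamiltonian (fermionTorusGraph 2 L) t U *ᵥ w) ⬝ᵥ
      hamiltonian (fermionTorusGraph 2 L) t U *ᵥ w).re ≤ r2 + ρ ^ 2)
    (hρσ : ρ < σ)
    {O : Matrix (Finset (Orb (FermionTorus 2 L))) (Finset (Orb (FermionTorus 2 L))) ℂ} {m h β : ℝ}
    (hOform : ∀ x : Fock (Orb (FermionTorus 2 L)),
      ‖star x ⬝ᵥ O *ᵥ x - (m : ℂ) * (star x ⬝ᵥ x)‖ ≤ h * (star x ⬝ᵥ x).re)
    (hβ : 0 ≤ β) (hβr : r2 ≤ β ^ 2 * (σ - ρ) ^ 2) :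
    |(((hamiltonian (fermionTorusGraph 2 L) t U).sectorGroundProj
          (nParticleSubmodule (ι := Orb (FermionTorus 2 L)) (L ^ 2))).projState O).re -
        (star w ⬝ᵥ O *ᵥ w).re| ≤ 2 * h * (β + β ^ 2) := by
  rw [← hubbardTorus_sectorGroundProj_szSector_eq hL ht hU]
  exact TempleKato.sector_expectation_enclosure
    (LiebThm1.hamiltonian_isHermitian (fermionTorusGraph 2 L) t U) _
    (fun v hv => hamiltonian_mulVec_mem_szSector (fermionTorusGraph 2 L) t U hv)
    hW hWK hwK hw1 hρ hr2 hρσ hOform hβ hβr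

end LiebHalfFilled

end Literature.MathematicalPhysics.QuantumLattice
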